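import Mathlib.Combinatorics.SimpleGraph.Connectivity.Connected
import Mathlib.Data.Set.Card
import HarnessLib

/-!
# Brambles and havens

Topic `Literature/Combinatorics/SimpleGraph`. The two dual objects to tree-width of
Seymour–Thomas's tree-width duality theorem ("tree-width `≥ k` iff a bramble of order `> k`
exists iff a haven of order `k + 1` exists", Seymour–Thomas 1993; Diestel, *Graph Theory*,
5th ed., Thm. 12.4.3), in the vocabulary of the tree (`Literature.Combinatorics.SimpleGraph.
TreeDecomposition`: `treewidth`). The duality theorem itself is proved in
`TreewidthDuality.lean`; this file only sets up the objects and the (easy) passage from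
brambles to havens, which is the form in which large tree-width is USED (a haven of order
`k + 1` is a winning strategy for the Robber against `k` cops in the cops-and-robber game of
Seymour–Thomas, and hence a strategy for Duplicator on Cai–Fürer–Immerman graphs: Chen–Flum–Liu
2025, Thm. 11.1, `Literature.ModelTheory.FiniteModelTheory.CFIUncolouredProofs`).

* `Touches G X Y` — "two subsets of `V(G)` touch if they have a vertex in common or `G` contains
  an edge between them" (Diestel §12.4);
* `IsConnectedSet G X` — a CONNECTED VERTEX SET: nonempty, any two of its vertices joined by a
  walk of `G` inside `X` (equivalently `G[X]` is connected, `isConnectedSet_iff`);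
* `IsBramble G ℬ` — "a set of mutually touching connected vertex sets"; `Covers X ℬ` — `X` meets
  every element of `ℬ` ("the least number of vertices covering a bramble is its ORDER"; we do not
  name the number and say "no `≤ k` vertices cover `ℬ`" for "order `> k`");
* `IsHaven G k β` — Seymour–Thomas's HAVEN OF ORDER `k`: to every set `X` of fewer than `k`
  vertices an `X`-flap `β X` (the vertex set of a component of `G - X`) with `β Y ⊆ β X`
  whenever `X ⊆ Y`; sizes are measured by `Set.encard` (so an infinite set never counts as
  "fewer than `k` vertices", and the notion is the printed one also on infinite graphs);
* `IsBramble.isHaven_brambleFlap` — a bramble not covered by any `≤ k` vertices yields a haven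
  of order `k + 1`: `β X :=` the component of `G - X` containing the (mutually touching, hence
  jointly connected) elements of `ℬ` disjoint from `X` (Seymour–Thomas 1993, (1.3)–(1.4);
  Diestel §12.4); `IsHaven.nonempty_of_ncard_le` & co. unpack a haven of order `k + 1` on a
  finite graph in terms of `Set.ncard ≤ k` (the shape used by pebble-game strategies).

## References

* [SeymourThomas1993] P. D. Seymour, R. Thomas, *Graph searching and a min-max theorem for
  tree-width*, J. Combin. Theory Ser. B 58 (1993) 22–33, §1 (havens, (1.3), Thm (1.4)).
* [Diestel2017] R. Diestel, *Graph Theory*, 5th ed., GTM 173 (2017), §12.4 (touching sets,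
  brambles, covers, order; Thm. 12.4.3). Read: galaxy `panama:346492191637568`,
  chars 1024985–1046000.
-/

namespace Literature.Combinatorics.SimpleGraph

open _root_.SimpleGraph

universe u

variable {V : Type u} (G : _root_.SimpleGraph V)

/-! ### Touching sets, connected vertex sets -/

/-- Two vertex sets **touch** if they share a vertex or are joined by an edge.
[cite: Diestel2017, §12.4 (touching sets)] -/
def Touches (X Y : Set V) : Prop :=
  (X ∩ Y).Nonempty ∨ ∃ x ∈ X, ∃ y ∈ Y, G.Adj x y

variable {G} in
/-- Touching is symmetric. [cite: Diestel2017, §12.4 (touching sets)] -/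
theorem Touches.symm {X Y : Set V} (h : Touches G X Y) : Touches G Y X := by
  rcases h with h | ⟨x, hx, y, hy, hxy⟩
  · exact Or.inl (by rwa [Set.inter_comm])
  · exact Or.inr ⟨y, hy, x, hx, hxy.symm⟩

variable {G} in
/-- Touching is monotone. [cite: Diestel2017, §12.4 (touching sets)] -/
theorem Touches.mono {X Y X' Y' : Set V} (h : Touches G X Y) (hX : X ⊆ X') (hY : Y ⊆ Y') :
    Touches G X' Y' := by
  rcases h with ⟨z, hz⟩ | ⟨x, hx, y, hy, hxy⟩
  · exact Or.inl ⟨z, hX hz.1, hY hz.2⟩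
  · exact Or.inr ⟨x, hX hx, y, hY hy, hxy⟩

/-- A **connected vertex set**: nonempty, and any two of its vertices are joined by a walk of `G`
all of whose vertices lie in the set (i.e. the induced subgraph `G[X]` is connected,
`isConnectedSet_iff`). [cite: Diestel2017, §12.4 (connected vertex sets)] -/
def IsConnectedSet (X : Set V) : Prop :=
  X.Nonempty ∧ ∀ ⦃a⦄, a ∈ X → ∀ ⦃b⦄, b ∈ X → ∃ W : G.Walk a b, ∀ z ∈ W.support, z ∈ X

variable {G}

/-- A single vertex is a connected vertex set. [folklore] -/
theorem isConnectedSet_singleton (v : V) : IsConnectedSet G {v} := by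
  refine ⟨⟨v, rfl⟩, fun a ha b hb => ?_⟩
  rw [Set.mem_singleton_iff] at ha hb
  subst ha hb
  exact ⟨Walk.nil, by simp⟩

/-- A walk of the induced subgraph `G[X]` is a walk of `G` inside `X`. [folklore] -/
theorem exists_walk_of_induce_walk {X : Set V} {a b : X} (W : (G.induce X).Walk a b) :
    ∃ W' : G.Walk a b, ∀ z ∈ W'.support, z ∈ X := by
  have hW : ∀ z ∈ (W.map (Embedding.induce X).toHom).support, z ∈ X := by
    intro z hz
    rw [Walk.support_map, List.mem_map] at hz
    obtain ⟨z', -, rfl⟩ := hz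
    exact z'.2
  exact ⟨_, hW⟩

/-- A walk of `G` inside `X` lifts to the induced subgraph `G[X]`. [folklore] -/
theorem induce_reachable_of_walk {X : Set V} :
    ∀ {a b : V} (W : G.Walk a b) (hW : ∀ z ∈ W.support, z ∈ X),
      (G.induce X).Reachable ⟨a, hW a W.start_mem_support⟩ ⟨b, hW b W.end_mem_support⟩
  | _, _, Walk.nil, _ => Reachable.refl _
  | a, b, Walk.cons (v := c) h W, hW => by
    have hc : c ∈ X := hW c (by simp)
    have hW' : ∀ z ∈ W.support, z ∈ X := fun z hz => hW z (by simp [hz])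
    have h1 : (G.induce X).Adj ⟨a, hW a (Walk.cons h W).start_mem_support⟩ ⟨c, hc⟩ := h
    exact h1.reachable.trans (induce_reachable_of_walk W hW')

/-- `IsConnectedSet G X` iff the induced subgraph `G[X]` is connected.
[cite: Diestel2017, §12.4 (connected vertex sets)] -/
theorem isConnectedSet_iff {X : Set V} : IsConnectedSet G X ↔ (G.induce X).Connected := by
  constructor
  · rintro ⟨⟨x, hx⟩, h⟩
    haveI : Nonempty X := ⟨⟨x, hx⟩⟩
    refine (connected_iff _).2 ⟨fun a b => ?_, inferInstance⟩
    obtain ⟨W, hW⟩ := h a.2 b.2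
    have := induce_reachable_of_walk W hW
    exact this
  · intro h
    obtain ⟨⟨x, hx⟩⟩ := h.nonempty
    refine ⟨⟨x, hx⟩, fun a ha b hb => ?_⟩
    obtain ⟨W⟩ := h.preconnected ⟨a, ha⟩ ⟨b, hb⟩
    exact exists_walk_of_induce_walk W

/-! ### Brambles and covers -/

variable (G) in
/-- A **bramble**: a set of mutually touching connected vertex sets.
[cite: Diestel2017, §12.4 (bramble)] -/
structure IsBramble (ℬ : Set (Set V)) : Prop where
  /-- every element is a connected vertex set -/
  isConnectedSet : ∀ ⦃B⦄, B ∈ ℬ → IsConnectedSet G B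
  /-- any two elements touch -/
  touches : ∀ ⦃B⦄, B ∈ ℬ → ∀ ⦃B'⦄, B' ∈ ℬ → Touches G B B'

/-- `X` **covers** `ℬ`: it meets every element of `ℬ`. The ORDER of a bramble is the least size
of a cover; "`ℬ` has order `> k`" is rendered as "no set of at most `k` vertices covers `ℬ`".
[cite: Diestel2017, §12.4 (cover, order)] -/
def Covers (X : Set V) (ℬ : Set (Set V)) : Prop :=
  ∀ ⦃B⦄, B ∈ ℬ → (B ∩ X).Nonempty

/-- `X` fails to cover `ℬ` iff some element of `ℬ` is disjoint from `X`. [folklore] -/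
theorem not_covers_iff {X : Set V} {ℬ : Set (Set V)} :
    ¬ Covers X ℬ ↔ ∃ B ∈ ℬ, Disjoint B X := by
  simp only [Covers, not_forall, Set.not_nonempty_iff_eq_empty, exists_prop,
    Set.disjoint_iff_inter_eq_empty]

/-- The empty family is a bramble (covered by every set). [folklore] -/
theorem isBramble_empty : IsBramble G (∅ : Set (Set V)) :=
  ⟨fun _ h => h.elim, fun _ h => h.elim⟩

/-- Sub-families of brambles are brambles. [folklore] -/
theorem IsBramble.mono {ℬ ℬ' : Set (Set V)} (h : IsBramble G ℬ) (hsub : ℬ' ⊆ ℬ) :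
    IsBramble G ℬ' :=
  ⟨fun _ hB => h.isConnectedSet (hsub hB), fun _ hB _ hB' => h.touches (hsub hB) (hsub hB')⟩

/-! ### Havens -/

variable (G) in
/-- A **haven of order `k`** (Seymour–Thomas): to every set `X` of fewer than `k` vertices it
assigns an `X`-FLAP `β X` — the vertex set of a component of `G - X`: nonempty, disjoint from
`X`, any two of its vertices joined by a walk avoiding `X`, and closed under neighbours outside
`X` — in such a way that `β Y ⊆ β X` whenever `X ⊆ Y`. Sizes are measured by `Set.encard`
(`ℕ∞`-valued: "`X.encard < k`" says that `X` is finite with fewer than `k` elements, as in the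
source's "`X ⊆ V(G)` with `|X| < k`"). A haven of order `k` is exactly a winning strategy for the
Robber against `k - 1` cops: he sits in `β` of the set of vertices held by the cops.
[cite: SeymourThomas1993, §1 (haven of order k)] -/
structure IsHaven (k : ℕ) (β : Set V → Set V) : Prop where
  /-- flaps are nonempty -/
  nonempty : ∀ ⦃X : Set V⦄, X.encard < k → (β X).Nonempty
  /-- flaps avoid the removed set -/
  not_mem : ∀ ⦃X : Set V⦄, X.encard < k → ∀ ⦃a⦄, a ∈ β X → a ∉ X
  /-- flaps are connected in `G - X` -/
  exists_walk : ∀ ⦃X : Set V⦄, X.encard < k → ∀ ⦃a⦄, a ∈ β X → ∀ ⦃b⦄, b ∈ β X →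
    ∃ W : G.Walk a b, ∀ z ∈ W.support, z ∉ X
  /-- flaps are closed under neighbours off `X` (they are whole components of `G - X`) -/
  mem_of_adj : ∀ ⦃X : Set V⦄, X.encard < k → ∀ ⦃a⦄, a ∈ β X → ∀ ⦃b⦄, G.Adj a b → b ∉ X → b ∈ β X
  /-- monotonicity: more cops, smaller flap -/
  anti : ∀ ⦃X Y : Set V⦄, X ⊆ Y → Y.encard < k → β Y ⊆ β X

/-! ### From brambles to havens -/

/-- The flap assigned to `X` by a bramble `ℬ`: everything reachable in `G - X` from an element of
`ℬ` disjoint from `X`. [cite: SeymourThomas1993, §1 ((1.3): screens/brambles give havens)] -/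
def brambleFlap (ℬ : Set (Set V)) (X : Set V) : Set V :=
  {v | ∃ B ∈ ℬ, Disjoint B X ∧ ∃ b ∈ B, ∃ W : G.Walk b v, ∀ z ∈ W.support, z ∉ X}

/-- An element of `ℬ` disjoint from `X` lies in the flap of `X`. [folklore] -/
theorem subset_brambleFlap {ℬ : Set (Set V)} {X B : Set V} (hB : B ∈ ℬ) (hBX : Disjoint B X) :
    B ⊆ brambleFlap (G := G) ℬ X := fun b hb =>
  ⟨B, hB, hBX, b, hb, Walk.nil, by simpa using Set.disjoint_left.1 hBX hb⟩

/-- Inside a connected vertex set disjoint from `X`, walks avoid `X`. [folklore] -/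
theorem IsConnectedSet.exists_walk_avoid {B X : Set V} (hB : IsConnectedSet G B)
    (hBX : Disjoint B X) {a b : V} (ha : a ∈ B) (hb : b ∈ B) :
    ∃ W : G.Walk a b, ∀ z ∈ W.support, z ∉ X := by
  obtain ⟨W, hW⟩ := hB.2 ha hb
  exact ⟨W, fun z hz => Set.disjoint_left.1 hBX (hW z hz)⟩

/-- Two touching connected vertex sets disjoint from `X` are joined by walks avoiding `X`.
[cite: Diestel2017, §12.4] -/
theorem exists_walk_avoid_of_touches {B B' X : Set V} (hB : IsConnectedSet G B)
    (hB' : IsConnectedSet G B') (ht : Touches G B B') (hBX : Disjoint B X) (hB'X : Disjoint B' X)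
    {a b : V} (ha : a ∈ B) (hb : b ∈ B') : ∃ W : G.Walk a b, ∀ z ∈ W.support, z ∉ X := by
  have happ : ∀ {p q r : V} (W₁ : G.Walk p q) (W₂ : G.Walk q r),
      (∀ z ∈ W₁.support, z ∉ X) → (∀ z ∈ W₂.support, z ∉ X) →
      ∀ z ∈ (W₁.append W₂).support, z ∉ X := by
    intro p q r W₁ W₂ h₁ h₂ z hz
    rw [Walk.mem_support_append_iff] at hz
    exact hz.elim (h₁ z) (h₂ z)
  rcases ht with ⟨c, hcB, hcB'⟩ | ⟨c, hc, c', hc', hcc'⟩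
  · obtain ⟨W₁, h₁⟩ := hB.exists_walk_avoid hBX ha hcB
    obtain ⟨W₂, h₂⟩ := hB'.exists_walk_avoid hB'X hcB' hb
    exact ⟨W₁.append W₂, happ W₁ W₂ h₁ h₂⟩
  · obtain ⟨W₁, h₁⟩ := hB.exists_walk_avoid hBX ha hc
    obtain ⟨W₂, h₂⟩ := hB'.exists_walk_avoid hB'X hc' hb
    refine ⟨W₁.append (Walk.cons hcc' W₂), happ W₁ _ h₁ fun z hz => ?_⟩
    rw [Walk.support_cons, List.mem_cons] at hz
    rcases hz with rfl | hz
    · exact h₁ z W₁.end_mem_support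
    · exact h₂ z hz

/-- `X.encard < k + 1 ↔ X.encard ≤ k` in `ℕ∞`. [folklore] -/
theorem encard_lt_add_one_iff {X : Set V} {k : ℕ} : X.encard < k + 1 ↔ X.encard ≤ k :=
  ENat.lt_add_one_iff (ENat.coe_ne_top k)

/-- **From a bramble of order `> k` to a haven of order `k + 1`.** If no set of at most `k`
vertices covers the bramble `ℬ`, then `X ↦ brambleFlap ℬ X` is a haven of order `k + 1`: for
`|X| ≤ k` some `B ∈ ℬ` misses `X`; all such `B` are connected, mutually touching and disjoint
from `X`, so they lie in one component of `G - X`, which shrinks as `X` grows. (The easy half of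
"bramble number `= ` haven order"; Seymour–Thomas phrase their theorem with havens, Diestel with
brambles.) [cite: SeymourThomas1993, §1 ((1.3), (1.4))] -/
theorem IsBramble.isHaven_brambleFlap {ℬ : Set (Set V)} (hℬ : IsBramble G ℬ) {k : ℕ}
    (hk : ∀ X : Set V, X.encard ≤ k → ¬ Covers X ℬ) :
    IsHaven G (k + 1) (brambleFlap (G := G) ℬ) where
  nonempty X hX := by
    obtain ⟨B, hB, hBX⟩ := not_covers_iff.1 (hk X (encard_lt_add_one_iff.1 (by exact_mod_cast hX)))
    obtain ⟨b, hb⟩ := (hℬ.isConnectedSet hB).1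
    exact ⟨b, subset_brambleFlap hB hBX hb⟩
  not_mem X _ a ha := by
    obtain ⟨B, -, -, b, -, W, hW⟩ := ha
    exact hW a W.end_mem_support
  exists_walk X _ a ha a' ha' := by
    obtain ⟨B, hB, hBX, b, hb, W, hW⟩ := ha
    obtain ⟨B', hB', hB'X, b', hb', W', hW'⟩ := ha'
    obtain ⟨U, hU⟩ := exists_walk_avoid_of_touches (hℬ.isConnectedSet hB)
      (hℬ.isConnectedSet hB') (hℬ.touches hB hB') hBX hB'X hb hb'
    refine ⟨W.reverse.append (U.append W'), fun z hz => ?_⟩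
    rw [Walk.mem_support_append_iff, Walk.mem_support_append_iff, Walk.support_reverse,
      List.mem_reverse] at hz
    rcases hz with hz | hz | hz
    · exact hW z hz
    · exact hU z hz
    · exact hW' z hz
  mem_of_adj X _ a ha c hac hc := by
    obtain ⟨B, hB, hBX, b, hb, W, hW⟩ := ha
    refine ⟨B, hB, hBX, b, hb, W.concat hac, fun z hz => ?_⟩
    rw [Walk.support_concat, List.mem_append, List.mem_singleton] at hz
    rcases hz with hz | rfl
    · exact hW z hz
    · exact hc
  anti X Y hXY _ v hv := by
    obtain ⟨B, hB, hBY, b, hb, W, hW⟩ := hv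
    exact ⟨B, hB, hBY.mono_right hXY, b, hb, W, fun z hz h => hW z hz (hXY h)⟩

/-! ### Havens of order `k + 1` on finite graphs, in terms of `Set.ncard ≤ k` -/

section Finite

variable [Finite V] {k : ℕ} {β : Set V → Set V}

/-- On a finite vertex type, `X.ncard ≤ k` means `X.encard < k + 1`. [folklore] -/
theorem encard_lt_succ_of_ncard_le {X : Set V} (hX : X.ncard ≤ k) : X.encard < (k + 1 : ℕ) := by
  rw [← X.toFinite.cast_ncard_eq]
  exact_mod_cast Nat.lt_succ_of_le hX

/-- A haven of order `k + 1` has nonempty flaps at all sets of at most `k` vertices.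
[cite: SeymourThomas1993, §1] -/
theorem IsHaven.nonempty_of_ncard_le (h : IsHaven G (k + 1) β) {X : Set V} (hX : X.ncard ≤ k) :
    (β X).Nonempty :=
  h.nonempty (encard_lt_succ_of_ncard_le hX)

/-- … the flaps avoid the removed set … [cite: SeymourThomas1993, §1] -/
theorem IsHaven.not_mem_of_ncard_le (h : IsHaven G (k + 1) β) {X : Set V} (hX : X.ncard ≤ k)
    {a : V} (ha : a ∈ β X) : a ∉ X :=
  h.not_mem (encard_lt_succ_of_ncard_le hX) ha

/-- … are connected avoiding it … [cite: SeymourThomas1993, §1] -/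
theorem IsHaven.exists_walk_of_ncard_le (h : IsHaven G (k + 1) β) {X : Set V} (hX : X.ncard ≤ k)
    {a b : V} (ha : a ∈ β X) (hb : b ∈ β X) : ∃ W : G.Walk a b, ∀ z ∈ W.support, z ∉ X :=
  h.exists_walk (encard_lt_succ_of_ncard_le hX) ha hb

/-- … and shrink as the set grows. [cite: SeymourThomas1993, §1] -/
theorem IsHaven.anti_of_ncard_le (h : IsHaven G (k + 1) β) {X Y : Set V} (hXY : X ⊆ Y)
    (hY : Y.ncard ≤ k) : β Y ⊆ β X :=
  h.anti hXY (encard_lt_succ_of_ncard_le hY)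

end Finite

/-- Non-vacuity: in the triangle `K₃` the three single vertices form a bramble that no single
vertex covers (order `2`; indeed `tw(K₃) = 2`). [cite: Diestel2017, §12.4] -/
example : IsBramble (⊤ : _root_.SimpleGraph (Fin 3)) {{0}, {1}, {2}} ∧
    ∀ X : Set (Fin 3), X.ncard ≤ 1 → ¬ Covers X ({{0}, {1}, {2}} : Set (Set (Fin 3))) := by
  refine ⟨⟨?_, ?_⟩, ?_⟩
  · rintro B (rfl | rfl | rfl) <;> exact isConnectedSet_singleton _
  · intro B hB B' hB'
    by_cases hBB' : B = B'
    · subst hBB'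
      rcases hB with rfl | rfl | rfl <;> exact Or.inl ⟨_, rfl, rfl⟩
    · have key : ∀ {C C' : Set (Fin 3)}, C ∈ ({{0}, {1}, {2}} : Set (Set (Fin 3))) →
          C' ∈ ({{0}, {1}, {2}} : Set (Set (Fin 3))) → C ≠ C' →
          ∃ x ∈ C, ∃ y ∈ C', (⊤ : _root_.SimpleGraph (Fin 3)).Adj x y := by
        rintro C C' (rfl | rfl | rfl) (rfl | rfl | rfl) hne <;>
          first
          | exact absurd rfl hne
          | exact ⟨_, rfl, _, rfl, by rw [top_adj]; decide⟩
      exact Or.inr (key hB hB' hBB')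
  · intro X hX hcov
    rcases (Set.ncard_le_one_iff_eq (Set.toFinite X)).1 hX with rfl | ⟨a, rfl⟩
    · simpa using hcov (B := {0}) (Or.inl rfl)
    · have h0 := hcov (B := {0}) (Or.inl rfl)
      have h1 := hcov (B := {1}) (Or.inr (Or.inl rfl))
      simp only [Set.inter_singleton_nonempty, Set.mem_singleton_iff] at h0 h1
      have : (0 : Fin 3) = 1 := h0.symm.trans h1
      exact absurd this (by decide)

end Literature.Combinatorics.SimpleGraph
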